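import Mathlib
import Summits.ValiantsHypothesis.ValiantsHypothesis.Theorems.FifoMatchingNNLinearDegreeCofactorHardShedWordHeartPrelim
import Summits.ValiantsHypothesis.ValiantsHypothesis.Theorems.FifoMatchingNNLinearDegreeCofactorHardQueueFreeMass
import HarnessLib

/-!
# Crux `NNLinearDegreeCofactorHard` (stmt-ValiantsHypothesis-23918), line `internal_cofactor`, stub S2b (ii):
# the DETERMINISTIC HEART (D*) for μ* = shedWord (unit U5): many S-boundaries, or many tests

For the shed word `shedWord R H E y` (bits `y` in the BAND `|fairWalk| < m` on `[H, E]`, balanced, `m ≤ freeCount R 0 H`)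
and every BALANCED set of positions `S` (`N < 3·#S ≤ 2N`) RESPECTED by the FIFO matching of the word, with
`σ t := [t ∈ S]`, S-items `isS k := !isRItem k`, S-boundaries `sBoundariesAll` (S-items whose colour `σ ∘ openTime` differs
from their S-predecessor's) and tests `testsAll` (S-pushes of `[H, E)` whose position colour differs from the front's):

  `heart`:  `N/6 − 2#R − (N − E) − F₀ − 3m ≤ (F₀ + m) · sBoundariesAll`  or
            `F₀ − m ≤ testsAll + 2m · (2 · sBoundariesAll + 1)`,   `F₀ := freeCount R 0 H`.

This is `QueueHistory.dichotomy` (U4) instantiated through `…ShedWordHistory` with the μ*-facts of `…ShedWordHeartPrelim`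
(NS, S-band windows `sPush ≤ sPop + 2m`, `sAlive = sContent ∈ (F₀ − m, F₀ + m)`, R-items ≤ #R, uncovered items of the last
partial generation ≤ F₀ + 3m) and the free mass of `…QueueFreeMass` (U2).  With `H = N^{2/3}`, `m = N^{7/12}`, `E = N − O(H)`,
`#R ≤ N/12` both alternatives force `sBoundariesAll + testsAll ≥ c·N^{1/12}` — the input of the LEAD's pricing / counts assembly.
Nothing here proves S2b, the crux or VP ≠ VNP (not proved). [folklore]
-/

noncomputable section

-- Sub = Summit single-conjunct layout: the duplicated namespace component is mandated by the tree.
set_option linter.dupNamespace false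

namespace Summit.ValiantsHypothesis.ValiantsHypothesis.Theorems.FifoMatching.NNLinearDegreeCofactorHard.ShedWord

open Finset Literature.Computability.AlgebraicComplexity
open Summit.ValiantsHypothesis.ValiantsHypothesis.Theorems.FifoMatching.NNMonotoneHard
open Summit.ValiantsHypothesis.ValiantsHypothesis.Theorems.FifoMatching.NNLinearDegreeCofactorHard.QueueHistory

variable {N : ℕ} (R : Finset (Fin N)) (H E : ℕ) (y : Fin N → Bool)

/-- The position colouring of a set of positions. [folklore] -/
def posColour (S : Finset (Fin N)) : ℕ → Bool := fun t => decide (t ∈ S.map Fin.valEmbedding)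

/-- ALL S-BOUNDARIES of the word for the split `S`: S-items (`¬isRItem`) among `(0, #openers)` whose colour
`posColour S ∘ openTime` differs from that of their S-predecessor `Nat.findGreatest (· is an S-item) (k − 1)`. [folklore] -/
def sBoundariesAll (S : Finset (Fin N)) : ℕ :=
  sBd (posColour S) (openTime R H E y) (fun k => !isRItem R H E y k) 0 (openerSet (shedWord R H E y)).card

/-- ALL TESTS of `[H, E)` for the split `S`: pushes creating an S-item at a position whose colour differs from the FRONT's
(`posColour S (openTime (pops …))`). [folklore] -/
def testsAll (S : Finset (Fin N)) : ℕ :=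
  sTests (shedLetter R H E y) (posColour S) (fun s => pushes (shedPrefix R H E y s)) (fun s => pops (shedPrefix R H E y s))
    (openTime R H E y) (isRItem R H E y) H E

/-! ### Counting helpers -/

/-- Pushes in `[u, v)`: `pushes (prefix v) − pushes (prefix u) = #{t ∈ [u,v) : push}`. [folklore] -/
theorem pushes_sub_pushes {u v : ℕ} (huv : u ≤ v) :
    pushes (shedPrefix R H E y v) - pushes (shedPrefix R H E y u) =
      ((Ico u v).filter fun t => shedLetter R H E y t = true).card := by
  classical
  rw [pushes_shedPrefix, pushes_shedPrefix]
  have hsplit : ((range v).filter fun t => shedLetter R H E y t = true) =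
      ((range u).filter fun t => shedLetter R H E y t = true) ∪ ((Ico u v).filter fun t => shedLetter R H E y t = true) := by
    rw [← filter_union, range_eq_Ico, range_eq_Ico, Ico_union_Ico_eq_Ico (Nat.zero_le u) huv]
  rw [hsplit, card_union_of_disjoint]
  · omega
  · rw [range_eq_Ico]; exact disjoint_filter_filter (Ico_disjoint_Ico_consecutive 0 u v)

/-- Pushes advance at most one per position. [folklore] -/
theorem pushes_sub_pushes_le {u v : ℕ} (huv : u ≤ v) :
    pushes (shedPrefix R H E y v) - pushes (shedPrefix R H E y u) ≤ v - u := by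
  rw [pushes_sub_pushes R H E y huv]
  exact (card_filter_le _ _).trans (by simp)

/-- **Pushes in `[u, v)` = S-pushes + R-pushes, and the R-pushes are at defects** (`v ≤ N`):
`pushes v − pushes u ≤ sPush[u,v) + #R`. [folklore] -/
theorem pushes_sub_pushes_le_sPush_add {u v : ℕ} (huv : u ≤ v) (hvN : v ≤ N) :
    pushes (shedPrefix R H E y v) - pushes (shedPrefix R H E y u) ≤
      sPush (shedLetter R H E y) (fun s => pushes (shedPrefix R H E y s)) (isRItem R H E y) u v + R.card := by
  classical
  rw [pushes_sub_pushes R H E y huv]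
  have hsplit : ((Ico u v).filter fun t => shedLetter R H E y t = true) ⊆
      ((Ico u v).filter fun t => shedLetter R H E y t = true ∧ isRItem R H E y (pushes (shedPrefix R H E y t)) = false) ∪
        ((R.map Fin.valEmbedding).filter fun t => u ≤ t) := by
    intro t ht
    rw [mem_filter, mem_Ico] at ht
    rw [mem_union, mem_filter, mem_filter, mem_Ico]
    by_cases hr : isRItem R H E y (pushes (shedPrefix R H E y t)) = false
    · exact Or.inl ⟨ht.1, ht.2, hr⟩
    · right
      rw [Bool.not_eq_false, isRItem_pushes R H E y (lt_of_lt_of_le ht.1.2 hvN) ht.2] at hr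
      refine ⟨?_, ht.1.1⟩
      simpa [isDefect] using hr
  refine (card_le_card hsplit).trans ((card_union_le _ _).trans ?_)
  unfold sPush
  apply Nat.add_le_add_left
  exact (card_filter_le _ _).trans (by rw [card_map])

/-- The colour count of a split: `#{t < N : posColour S t} = #S`. [folklore] -/
theorem card_filter_posColour (S : Finset (Fin N)) :
    ((range N).filter fun t => posColour S t = true).card = S.card := by
  classical
  rw [← card_map Fin.valEmbedding]
  congr 1
  ext t
  simp only [posColour, mem_filter, mem_range, decide_eq_true_eq, mem_map, Fin.valEmbedding_apply]
  constructor
  · rintro ⟨-, h⟩; exact h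
  · rintro ⟨i, hi, rfl⟩; exact ⟨i.isLt, i, hi, rfl⟩

/-! ### Generations of the shed word in the band -/

/-- **Generations in the band**: while `T j ≤ E` the queue at `T j` is non-empty, `H ≤ T j`, and `T j < T (j+1)`; some
generation passes `E`. [folklore] -/
theorem gens_shedWord (hbal : (closerSet (shedWord R H E y)).card = (openerSet (shedWord R H E y)).card)
    (hHE : H ≤ E) (hEN : E ≤ N) {w : ℕ} (hw : w ≤ freeCount R 0 H)
    (hband : ∀ s, H ≤ s → s ≤ E → |fairWalk R H E y s| < w) :
    (∀ j, (∀ i ≤ j, genTime (closeTime R H E y hbal) (fun s => pushes (shedPrefix R H E y s)) H i ≤ E) →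
      ∀ i ≤ j, H ≤ genTime (closeTime R H E y hbal) (fun s => pushes (shedPrefix R H E y s)) H i ∧
        pops (shedPrefix R H E y (genTime (closeTime R H E y hbal) (fun s => pushes (shedPrefix R H E y s)) H i)) <
          pushes (shedPrefix R H E y (genTime (closeTime R H E y hbal) (fun s => pushes (shedPrefix R H E y s)) H i)) ∧
        genTime (closeTime R H E y hbal) (fun s => pushes (shedPrefix R H E y s)) H i <
          genTime (closeTime R H E y hbal) (fun s => pushes (shedPrefix R H E y s)) H (i + 1)) ∧
    ∃ j, E < genTime (closeTime R H E y hbal) (fun s => pushes (shedPrefix R H E y s)) H (j + 1) := by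
  set T := genTime (closeTime R H E y hbal) (fun s => pushes (shedPrefix R H E y s)) H with hT
  have step : ∀ t, H ≤ t → t ≤ E → pops (shedPrefix R H E y t) < pushes (shedPrefix R H E y t) ∧
      t < gen (closeTime R H E y hbal) (fun s => pushes (shedPrefix R H E y s)) t := by
    intro t hHt htE
    have hne := (sContent_mem_band R H E y hEN hw hHt htE fun s h1 h2 => hband s h1 (h2.trans htE)).2
    have hn : pushes (shedPrefix R H E y t) ≤ (openerSet (shedWord R H E y)).card := by
      rw [← pushes_shedPrefix_N]; exact pushes_mono R H E y (htE.trans hEN)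
    exact ⟨hne, lt_gen (c := closeTime R H E y hbal) (rO := fun s => pushes (shedPrefix R H E y s))
      (fun k t hk => closeTime_lt_iff R H E y hbal hk t) hne hn⟩
  have main : ∀ j, (∀ i ≤ j, T i ≤ E) → ∀ i ≤ j, H ≤ T i ∧
      pops (shedPrefix R H E y (T i)) < pushes (shedPrefix R H E y (T i)) ∧ T i < T (i + 1) := by
    intro j hj i hi
    induction i with
    | zero =>
      have h0 : T 0 = H := rfl
      obtain ⟨hne, hlt⟩ := step H le_rfl hHE
      refine ⟨le_of_eq h0.symm, by rw [h0]; exact hne, ?_⟩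
      show T 0 < gen _ _ (T 0); rw [h0]; exact hlt
    | succ i ih =>
      obtain ⟨hH, _, hlt⟩ := ih (Nat.le_of_succ_le hi)
      have hH' : H ≤ T (i + 1) := hH.trans (le_of_lt hlt)
      obtain ⟨hne, hlt'⟩ := step (T (i + 1)) hH' (hj (i + 1) hi)
      exact ⟨hH', hne, hlt'⟩
  refine ⟨main, ?_⟩
  by_contra hall
  push Not at hall
  have hle : ∀ j, T j ≤ E := fun j => by cases j with | zero => exact hHE | succ j => exact hall j
  have key : ∀ j, H + j ≤ T j := by
    intro j
    induction j with
    | zero => simp [hT]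
    | succ j ih => have := (main (j + 1) (fun i _ => hle i) j (Nat.le_succ j)).2.2; omega
  have := key (E + 1); have := hle (E + 1); omega

/-! ### The heart -/

/-- **(D*) for μ* = shedWord.**  See the module docstring. [folklore] -/
theorem heart (hbal : (closerSet (shedWord R H E y)).card = (openerSet (shedWord R H E y)).card)
    (hHE : H ≤ E) (hEN : E ≤ N) {w : ℕ} (hw : w ≤ freeCount R 0 H)
    (hband : ∀ s, H ≤ s → s ≤ E → |fairWalk R H E y s| < w)
    (S : Finset (Fin N)) (hS₁ : N < 3 * S.card) (hS₂ : 3 * S.card ≤ 2 * N)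
    (hresp : ∀ i, i ∈ S ↔ fifo (shedWord R H E y) hbal i ∈ S) :
    N / 6 - 2 * R.card - (N - E) - freeCount R 0 H - 3 * w ≤ (freeCount R 0 H + w) * sBoundariesAll R H E y S ∨
      freeCount R 0 H - w ≤ testsAll R H E y S + 2 * w * (2 * sBoundariesAll R H E y S + 1) := by
  classical
  -- axioms of the abstract history
  have hO0 : (fun s => pushes (shedPrefix R H E y s)) 0 = 0 := rfl
  have hC0 : (fun s => pops (shedPrefix R H E y s)) 0 = 0 := rfl
  have hOs : ∀ t, (fun s => pushes (shedPrefix R H E y s)) (t + 1) =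
      (fun s => pushes (shedPrefix R H E y s)) t + (if shedLetter R H E y t = true then 1 else 0) := fun t => rankO_succ R H E y t
  have hCs : ∀ t, (fun s => pops (shedPrefix R H E y s)) (t + 1) =
      (fun s => pops (shedPrefix R H E y s)) t + (if shedLetter R H E y t = true then 0 else 1) := fun t => rankC_succ R H E y t
  have ho : ∀ k t, k < (openerSet (shedWord R H E y)).card →
      (openTime R H E y k < t ↔ k < (fun s => pushes (shedPrefix R H E y s)) t) := fun k t hk => openTime_lt_iff R H E y hk t
  have hc : ∀ k t, k < (openerSet (shedWord R H E y)).card →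
      (closeTime R H E y hbal k < t ↔ k < (fun s => pops (shedPrefix R H E y s)) t) :=
    fun k t hk => closeTime_lt_iff R H E y hbal hk t
  have hrespn : ∀ k, k < (openerSet (shedWord R H E y)).card →
      posColour S (openTime R H E y k) = posColour S (closeTime R H E y hbal k) := by
    intro k hk
    have h := colour_openTime_eq R H E y hbal S hresp hk
    simp only [posColour]
    rw [decide_eq_decide]; exact h
  -- generations
  set T := genTime (closeTime R H E y hbal) (fun s => pushes (shedPrefix R H E y s)) H with hT
  obtain ⟨hgens, hex⟩ := gens_shedWord R H E y hbal hHE hEN hw hband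
  have hTgt : E < T (Nat.find hex + 1) := Nat.find_spec hex
  have hTmin : ∀ j < Nat.find hex, ¬ E < T (j + 1) := fun j hj => Nat.find_min hex hj
  generalize hmB : Nat.find hex = mB at hTgt hTmin
  have hTle : ∀ j ≤ mB, T j ≤ E := by
    intro j hj
    cases j with
    | zero => exact hHE
    | succ j => exact not_lt.1 (hTmin j (Nat.lt_of_succ_le hj))
  have hG := hgens mB hTle
  have hne : ∀ j ≤ mB, (fun s => pops (shedPrefix R H E y s)) (T j) < (fun s => pushes (shedPrefix R H E y s)) (T j) :=
    fun j hj => (hG j hj).2.1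
  have hn : ∀ j ≤ mB, (fun s => pushes (shedPrefix R H E y s)) (T j) ≤ (openerSet (shedWord R H E y)).card := fun j hj => by
    show pushes _ ≤ _; rw [← pushes_shedPrefix_N]; exact pushes_mono R H E y ((hTle j hj).trans hEN)
  have hHT : ∀ j ≤ mB, H ≤ T j := fun j hj => (hG j hj).1
  -- NS
  have hNS : ∀ t, H ≤ t → t < T mB → shedLetter R H E y t = true →
      (fun k => !isRItem R H E y k) ((fun s => pushes (shedPrefix R H E y s)) t) = true →
      (fun k => !isRItem R H E y k) ((fun s => pops (shedPrefix R H E y s)) t) = true := by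
    intro t hHt htT hpush hS
    have htE : t < E := lt_of_lt_of_le htT (hTle mB le_rfl)
    have hne' := (sContent_mem_band R H E y hEN hw hHt (le_of_lt htE) fun s h1 h2 => hband s h1 (h2.trans (le_of_lt htE))).2
    exact ns_shedWord R H E y hEN hHt htE hne' hpush hS
  -- band windows
  have hbandw : ∀ j < mB, ∀ u v, T j ≤ u → u ≤ v → v ≤ T (j + 1) →
      sPush (shedLetter R H E y) (fun s => pushes (shedPrefix R H E y s)) (fun k => !(fun k => !isRItem R H E y k) k) u v ≤
        sPop (shedLetter R H E y) (fun s => pops (shedPrefix R H E y s)) (fun k => !(fun k => !isRItem R H E y k) k) u v + 2 * w := by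
    intro j hj u v hu huv hv
    simp only [Bool.not_not]
    exact sPush_le_sPop_add R H E y hEN hw ((hHT j (le_of_lt hj)).trans hu) huv (hv.trans (hTle (j + 1) hj)) hband
  -- band on the alive S-count
  have hZ : ∀ j ≤ mB, freeCount R 0 H - w ≤ sAlive (fun s => pushes (shedPrefix R H E y s)) (fun s => pops (shedPrefix R H E y s))
      (fun k => !isRItem R H E y k) (T j) ∧ sAlive (fun s => pushes (shedPrefix R H E y s)) (fun s => pops (shedPrefix R H E y s))
      (fun k => !isRItem R H E y k) (T j) ≤ freeCount R 0 H + w := by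
    intro j hj
    rw [sAlive_eq_sContent]
    have h := (sContent_mem_band R H E y hEN hw (hHT j hj) (hTle j hj) fun s h1 h2 => hband s h1 (h2.trans (hTle j hj))).1
    omega
  -- free mass
  have hOM : (fun s => pushes (shedPrefix R H E y s)) N = (openerSet (shedWord R H E y)).card := pushes_shedPrefix_N R H E y
  have hCM : (fun s => pops (shedPrefix R H E y s)) N = (openerSet (shedWord R H E y)).card := by
    show pops _ = _; rw [pops_shedPrefix_N, hbal]
  have hcol : ((range N).filter fun t => posColour S t = true).card = S.card := card_filter_posColour S
  have hsix : ∀ b : Bool, N ≤ 6 * ((range (openerSet (shedWord R H E y)).card).filter fun k =>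
      posColour S (openTime R H E y k) = b).card := fun b =>
    le_six_mul_card_items_colour (σ := posColour S) hOs hCs ho hc hrespn hOM hCM (by rw [hcol]; exact hS₁) (by rw [hcol]; exact hS₂) b
  -- uncovered items: pushes in `[T mB, N)`
  have hpopsH : pops (shedPrefix R H E y H) = 0 := pops_fill R H E y le_rfl
  have hunc : (openerSet (shedWord R H E y)).card - pushes (shedPrefix R H E y (T mB)) ≤
      (N - E) + R.card + (freeCount R 0 H + w) + 2 * w := by
    have h1 := pushes_sub_pushes_le R H E y hEN
    have h2 := pushes_sub_pushes_le_sPush_add R H E y (hTle mB le_rfl) hEN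
    have h3 : sPush (shedLetter R H E y) (fun s => pushes (shedPrefix R H E y s)) (isRItem R H E y) (T mB) E ≤
        sPop (shedLetter R H E y) (fun s => pops (shedPrefix R H E y s)) (isRItem R H E y) (T mB) E + 2 * w :=
      sPush_le_sPop_add R H E y hEN hw (hHT mB le_rfl) (hTle mB le_rfl) le_rfl hband
    have h4 : sPop (shedLetter R H E y) (fun s => pops (shedPrefix R H E y s)) (isRItem R H E y) (T mB) E ≤ sContent R H E y (T mB) :=
      sPop_le_sAlive R H E y hbal S (hne mB le_rfl) ((hTle mB le_rfl).trans hEN) (le_of_lt hTgt)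
    have h5 := ((hZ mB le_rfl).2)
    rw [sAlive_eq_sContent] at h5
    rw [← pushes_shedPrefix_N]
    have hmono := pushes_mono R H E y (hTle mB le_rfl)
    have hmono' := pushes_mono R H E y hEN
    omega
  have hQ : ∀ b : Bool, N / 6 - 2 * R.card - (N - E) - freeCount R 0 H - 3 * w ≤
      ((Ico ((fun s => pops (shedPrefix R H E y s)) H) ((fun s => pushes (shedPrefix R H E y s)) (T mB))).filter fun k =>
        (fun k => !isRItem R H E y k) k = true ∧ posColour S (openTime R H E y k) = b).card := by
    intro b
    have hcover : ((range (openerSet (shedWord R H E y)).card).filter fun k => posColour S (openTime R H E y k) = b) ⊆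
        (((Ico (pops (shedPrefix R H E y H)) (pushes (shedPrefix R H E y (T mB)))).filter fun k =>
            (!isRItem R H E y k) = true ∧ posColour S (openTime R H E y k) = b) ∪
          ((range (openerSet (shedWord R H E y)).card).filter fun k => isRItem R H E y k = true)) ∪
          Ico (pushes (shedPrefix R H E y (T mB))) (openerSet (shedWord R H E y)).card := by
      intro k hk
      rw [mem_filter, mem_range] at hk
      rw [mem_union, mem_union, mem_filter, mem_filter, mem_Ico, mem_Ico, mem_range, hpopsH]
      by_cases hr : isRItem R H E y k = true
      · exact Or.inl (Or.inr ⟨hk.1, hr⟩)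
      · by_cases hlt : k < pushes (shedPrefix R H E y (T mB))
        · exact Or.inl (Or.inl ⟨⟨Nat.zero_le _, hlt⟩, by simpa using hr, hk.2⟩)
        · exact Or.inr ⟨not_lt.1 hlt, hk.1⟩
    have h1 := (card_le_card hcover).trans ((card_union_le _ _).trans (Nat.add_le_add_right (card_union_le _ _) _))
    rw [Nat.card_Ico] at h1
    have h2 := card_rItems_le R H E y
    have h3 := hsix b
    have h4 := hunc
    simp only []
    omega
  -- the dichotomy
  have hD := dichotomy (W := shedLetter R H E y) (σ := posColour S) (rO := fun s => pushes (shedPrefix R H E y s))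
    (rC := fun s => pops (shedPrefix R H E y s)) (o := openTime R H E y) (c := closeTime R H E y hbal)
    (n' := (openerSet (shedWord R H E y)).card) (isS := fun k => !isRItem R H E y k) hOs hCs ho hc
    (A := H) (m := mB) (D := 2 * w) (Zmax := freeCount R 0 H + w) (Zmin := freeCount R 0 H - w)
    (Q := N / 6 - 2 * R.card - (N - E) - freeCount R 0 H - 3 * w)
    hne hn hNS hbandw (fun j hj => (hZ j hj).2) (fun j hj => (hZ j hj).1) hQ
  -- weaken to the all-window quantities
  have hSbd : sBd (posColour S) (openTime R H E y) (fun k => !isRItem R H E y k) ((fun s => pops (shedPrefix R H E y s)) H)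
      ((fun s => pushes (shedPrefix R H E y s)) (T mB)) ≤ sBoundariesAll R H E y S := by
    unfold sBoundariesAll sBd
    refine card_le_card (filter_subset_filter _ (Ioo_subset_Ioo (by simp [hpopsH]) ?_))
    rw [← pushes_shedPrefix_N]; exact pushes_mono R H E y ((hTle mB le_rfl).trans hEN)
  have hTests : sTests (shedLetter R H E y) (posColour S) (fun s => pushes (shedPrefix R H E y s))
      (fun s => pops (shedPrefix R H E y s)) (openTime R H E y) (fun k => !(fun k => !isRItem R H E y k) k) H (T mB) ≤
      testsAll R H E y S := by
    unfold testsAll sTests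
    refine card_le_card fun t ht => ?_
    rw [mem_filter, mem_Ico] at ht ⊢
    refine ⟨⟨ht.1.1, lt_of_lt_of_le ht.1.2 (hTle mB le_rfl)⟩, ht.2.1, ?_, ht.2.2.2⟩
    simpa using ht.2.2.1
  rcases hD with h | h
  · left
    exact h.trans (Nat.mul_le_mul_left _ hSbd)
  · right
    exact h.trans (Nat.add_le_add hTests (Nat.mul_le_mul_left _ (Nat.add_le_add_right (Nat.mul_le_mul_left _ hSbd) 1)))

end Summit.ValiantsHypothesis.ValiantsHypothesis.Theorems.FifoMatching.NNLinearDegreeCofactorHard.ShedWord
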